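import Literature.NumberTheory.Transcendental.NesterenkoEliminationFacts
import Literature.NumberTheory.Transcendental.NesterenkoEliminationChowForm
import Mathlib.RingTheory.MvPolynomial.WeightedHomogeneous
import HarnessLib

/-!
# LNM 1752 Ch. 3 Proposition 4.7 from Proposition 4.4 — the product formula and part 1) (degrees); proofs only

`Literature/NumberTheory/Transcendental/NesterenkoEliminationProp47Proofs.lean` — proofs-only sibling of
`NesterenkoEliminationFacts.lean` (topic `Literature/NumberTheory/Transcendental`). No new definitions of
any kind, no new named facts.

Proposition 4.7 of Nesterenko's "algebraic fundamentals" (Nesterenko–Philippon (eds.), LNM 1752, Ch. 3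
§4, p. 39; "PROOF. See [Nes10, Proposition 1.2]") compares degree, height and absolute value of a
homogeneous unmixed ideal `I` with those of its associated primes `𝔭_j = √I_j`, weighted by the
exponents `k_j` of the primary components. Its proof rests on Proposition 4.4 (the associated form of
`I` is `F = F₁^{k₁} ⋯ F_s^{k_s}`, `F_j` the associated form of `𝔭_j`) — vendored in the tree as the named
fact `NesterenkoPhilippon2001_ch3_prop_4_4` — plus Gelfond-type inequalities for heights of products of
polynomials (parts 2 and 3). This file does the algebraic half, CONDITIONALLY on Proposition 4.4 taken
as a hypothesis `(h44 : NesterenkoPhilippon2001_ch3_prop_4_4)`: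

* `exists_chowForm_eq_C_mul_prod` — from `h44`: every `chowForm √Q r` (`Q` a primary component) is
  non-zero and `chowForm I r = C c * ∏_Q (chowForm √Q r)^{k_Q}` for some `c ∈ ℚ`, `c ≠ 0` (the tree's
  `chowForm` is a CHOSEN generator of `Ī(r)`, so Proposition 4.4's `F = ∏ F_j^{k_j}` holds up to a unit
  of `ℚ[U]`, i.e. a non-zero constant);
* `chowForm_isWeightedHomogeneous` — every associated form is homogeneous of degree `deg` in each block
  `uᵢ` (the remark after Proposition 4.4; unconditional, repackaging the tree's
  `bdeg_eq_ideg_of_mem_support_chowForm` as Mathlib's `IsWeightedHomogeneous` for the weight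
  indicator of the block `uᵢ`);
* `sum_primaryExponent_mul_ideg_eq` — **Proposition 4.7 1)**: `∑_Q k_Q · deg √Q = deg I`, from the two
  items above (block degrees add on products of non-zero block-homogeneous polynomials).

The grading instance `MvPolynomial.gradedAlgebra` (an `abbrev`, activated locally in the facts file)
is supplied here inside the hypothesis types with `letI`, so that they are syntactically the
hypotheses of the named facts.

Parts 2) and 3) (heights and values: Gauss's lemma at the finite places and Gelfond's lemma,
Bombieri–Gubler §1.6, at the archimedean one) are not in this file.

## References

* [NesterenkoPhilippon2001] Yu. V. Nesterenko, P. Philippon (eds.), *Introduction to Algebraic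
  Independence Theory*, LNM 1752, Springer 2001, Ch. 3 (Yu. V. Nesterenko) §4: Prop. 4.4 and the remark
  after it (p. 38), Def. 4.5 (p. 38), Prop. 4.7 (p. 39); PDF page = book page + 12.
* [Nes10] Yu. V. Nesterenko, Proc. Steklov Inst. Math. 218 (1997) 294–331, Prop. 1.2 (the proof referred to).
-/

noncomputable section

open MvPolynomial

namespace Literature.NumberTheory.Transcendental

namespace Nesterenko

variable {m : ℕ}

/-! ### The product formula of Proposition 4.4 for the chosen generators -/

/-- **Proposition 4.4 for the tree's chosen generators.** Under the hypotheses of Proposition 4.4/4.7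
(`I` homogeneous unmixed with `dim I = r − 1`, `1 ≤ r ≤ m`, `t` its reduced primary decomposition), and
given Proposition 4.4: every `chowForm √Q r`, `Q ∈ t`, is non-zero, and
`chowForm I r = C c * ∏_{Q ∈ t} (chowForm √Q r)^{k_Q}` for a non-zero rational `c` (`k_Q` the exponent
of `Q`). [cite: NesterenkoPhilippon2001, Ch. 3 Prop. 4.4 (p. 38)] -/
theorem exists_chowForm_eq_C_mul_prod (h44 : NesterenkoPhilippon2001_ch3_prop_4_4) {r : ℕ}
    {I : Ideal (Rx m)} (hr1 : 1 ≤ r) (hrm : r ≤ m)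
    (hIh : letI := MvPolynomial.gradedAlgebra (σ := Fin (m + 1)) (R := ℚ)
      I.IsHomogeneous (homogeneousSubmodule (Fin (m + 1)) ℚ)) (hI : IsUnmixedOfRank I r)
    {t : Finset (Ideal (Rx m))} (ht : Submodule.IsMinimalPrimaryDecomposition I t) :
    (∀ Q ∈ t, chowForm Q.radical r ≠ 0) ∧
      ∃ c : ℚ, c ≠ 0 ∧
        chowForm I r = C c * ∏ Q ∈ t, chowForm Q.radical r ^ primaryExponent Q := by
  obtain ⟨hPI, hPQ, hF, -⟩ := h44 m r I hr1 hrm hIh hI t ht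
  have hspan : ∀ Q ∈ t, Ideal.span {chowForm Q.radical r} = elimIdeal Q.radical r :=
    fun Q hQ => span_chowForm _ _ (hPQ Q hQ)
  obtain ⟨hirr, hprod⟩ := hF (fun Q => chowForm Q.radical r) hspan
  refine ⟨fun Q hQ => (hirr Q hQ).ne_zero, ?_⟩
  rw [← span_chowForm I r hPI] at hprod
  obtain ⟨u, hu⟩ := Ideal.span_singleton_eq_span_singleton.mp hprod
  obtain ⟨c, hc, hcu⟩ := MvPolynomial.isUnit_iff_eq_C_of_isReduced.mp u.isUnit
  exact ⟨c, hc.ne_zero, by rw [← hu, hcu, mul_comm]⟩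

/-! ### Block-homogeneity as `IsWeightedHomogeneous` -/

/-! Throughout, the *block weight* of the block `uᵢ` is the function
`fun v : Fin r × Fin (m + 1) => if v.1 = i then (1 : ℕ) else 0` (`1` on `u_{ij}`, `0` on the other
blocks), written inline (this proofs-only file introduces no definitions); the weighted degree of a
monomial for it is the degree `deg_{uᵢ}` in that block. -/

/-- The block-`uᵢ` weight of an exponent is its degree in the block `uᵢ` (the tree's `bdeg`).
[folklore] -/
theorem weight_block_eq_bdeg {r : ℕ} (i : Fin r) (γ : Fin r × Fin (m + 1) →₀ ℕ) :
    Finsupp.weight (fun v : Fin r × Fin (m + 1) => if v.1 = i then (1 : ℕ) else 0) γ = bdeg i γ := by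
  classical
  rw [Finsupp.weight_apply, Finsupp.sum_fintype _ _ (fun v => by simp)]
  simp only [smul_eq_mul, mul_ite, mul_one, mul_zero]
  rw [Fintype.sum_prod_type, Finset.sum_eq_single i (fun i' _ hi' => by simp [hi'])
    (fun h => absurd (Finset.mem_univ i) h)]
  simp [bdeg]

/-- **Remark after Proposition 4.4** in Mathlib's language: the associated form of index `r ≥ 1` of any
ideal is weighted-homogeneous of weight `deg I` for the weight of each block `uᵢ` (for a non-principal `Ī(r)` the
tree's `chowForm` is `0`, trivially homogeneous). [cite: NesterenkoPhilippon2001, Ch. 3, remark after Prop. 4.4 (p. 38)] -/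
theorem chowForm_isWeightedHomogeneous (J : Ideal (Rx m)) {r : ℕ} (hr : 0 < r) (i : Fin r) :
    IsWeightedHomogeneous (fun v : Fin r × Fin (m + 1) => if v.1 = i then (1 : ℕ) else 0)
      (chowForm J r) (ideg J r) := by
  intro γ hγ
  rw [weight_block_eq_bdeg]
  exact bdeg_eq_ideg_of_mem_support_chowForm J hr (mem_support_iff.mpr hγ) i

/-- For a non-zero polynomial that is weighted-homogeneous of weight `n` for the weight of the block `uᵢ`, the block
degree `deg_{uᵢ}` is `n`. [folklore] -/
theorem blockDeg_eq_of_isWeightedHomogeneous {r : ℕ} {i : Fin r} {G : RU r m} {n : ℕ}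
    (hG : IsWeightedHomogeneous (fun v : Fin r × Fin (m + 1) => if v.1 = i then (1 : ℕ) else 0) G n) (hG0 : G ≠ 0) : blockDeg G i = n := by
  change G.support.sup (bdeg i) = n
  apply le_antisymm
  · refine Finset.sup_le fun δ hδ => ?_
    rw [← weight_block_eq_bdeg, hG (mem_support_iff.mp hδ)]
  · obtain ⟨δ, hδ⟩ : ∃ δ, coeff δ G ≠ 0 := exists_coeff_ne_zero hG0
    rw [← hG hδ, weight_block_eq_bdeg]
    exact Finset.le_sup (f := bdeg i) (mem_support_iff.mpr hδ)

/-! ### Proposition 4.7 1) -/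

/-- **LNM 1752 Ch. 3 Proposition 4.7 1)** (from Proposition 4.4). Let `I ⊂ ℚ[x₀, …, x_m]` be a
homogeneous unmixed ideal with `dim I = r − 1`, `1 ≤ r ≤ m`, `t` its reduced primary decomposition,
`k_Q` the exponent of the component `Q`. Then `∑_{Q ∈ t} k_Q · deg √Q = deg I`. Proof: by
Proposition 4.4, `F_I = c ∏ F_{√Q}^{k_Q}` with `c ≠ 0` and all `F_{√Q} ≠ 0`; each `F_{√Q}` is
homogeneous of degree `deg √Q` in the block `u₁`, so the (non-zero) product is homogeneous of degree
`∑ k_Q deg √Q` in `u₁`, and `deg I = deg_{u₁} F_I`.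
[cite: NesterenkoPhilippon2001, Ch. 3 Prop. 4.7 1) (p. 39)] -/
theorem sum_primaryExponent_mul_ideg_eq (h44 : NesterenkoPhilippon2001_ch3_prop_4_4) {r : ℕ}
    {I : Ideal (Rx m)} (hr1 : 1 ≤ r) (hrm : r ≤ m)
    (hIh : letI := MvPolynomial.gradedAlgebra (σ := Fin (m + 1)) (R := ℚ)
      I.IsHomogeneous (homogeneousSubmodule (Fin (m + 1)) ℚ)) (hI : IsUnmixedOfRank I r)
    {t : Finset (Ideal (Rx m))} (ht : Submodule.IsMinimalPrimaryDecomposition I t) :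
    ∑ Q ∈ t, primaryExponent Q * ideg Q.radical r = ideg I r := by
  have hr : 0 < r := hr1
  obtain ⟨hne, c, hc, hprod⟩ := exists_chowForm_eq_C_mul_prod h44 hr1 hrm hIh hI ht
  set i₀ : Fin r := ⟨0, hr⟩
  set w : Fin r × Fin (m + 1) → ℕ := fun v => if v.1 = i₀ then 1 else 0
  set G : RU r m := ∏ Q ∈ t, chowForm Q.radical r ^ primaryExponent Q with hG
  -- `G` is block-homogeneous of weight `∑ k_Q deg √Q` in the block `u₁`, and non-zero
  have hGhom : IsWeightedHomogeneous w G
      (∑ Q ∈ t, primaryExponent Q * ideg Q.radical r) := by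
    have h := IsWeightedHomogeneous.prod t (fun Q => chowForm Q.radical r ^ primaryExponent Q)
      (fun Q => primaryExponent Q * ideg Q.radical r) (w := w) (fun Q _ => by
        simpa [smul_eq_mul] using (chowForm_isWeightedHomogeneous Q.radical hr i₀).pow (primaryExponent Q))
    simpa [hG] using h
  have hG0 : G ≠ 0 := by
    rw [hG, Finset.prod_ne_zero_iff]
    exact fun Q hQ => pow_ne_zero _ (hne Q hQ)
  -- hence so is `F_I = C c * G`
  have hFhom : IsWeightedHomogeneous w (chowForm I r)
      (∑ Q ∈ t, primaryExponent Q * ideg Q.radical r) := by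
    rw [hprod]
    simpa using (isWeightedHomogeneous_C w c).mul hGhom
  have hF0 : chowForm I r ≠ 0 := by
    rw [hprod]
    exact mul_ne_zero (by simpa using hc) hG0
  have hideg : ideg I r = blockDeg (chowForm I r) i₀ := by
    rw [ideg, dif_pos hr]
  rw [hideg, blockDeg_eq_of_isWeightedHomogeneous hFhom hF0]

end Nesterenko

end Literature.NumberTheory.Transcendental

end
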